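import Summits.BirchSwinnertonDyer.Rank1Residual.Additive.CensusX42Height
import Summits.BirchSwinnertonDyer.Rank1Residual.Additive.GordRankOneKatoCertificateBSD
import Summits.BirchSwinnertonDyer.Rank1Residual.X2.AnalyticInvariants
import Literature.NumberTheory.EllipticCurves.GrossZagierRationalPoint
import HarnessLib

/-!
# Census relation X4-2: the ONE-NODE theorem on the (G-ord, `e = 2`) rows — the typed census relation
# AT THE PAIR + the one-number branch certificate + Kato's (resp. Wuthrich's) divisibility + a
# Delbourgo (B)-datum ⟹ `BSD(E,p)` (cell `b2b-bsdres`, census cell `bsd-formula-census`, seat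
# `b2b-bsdres-census-ctyper1` = conjecture-typer 1, gen 3; schema `census/TYPED-RELATIONS.md` §2.4;
# RESIDUAL-MAP O7-ord)

HONEST FRAMING (cell `b2b-bsdres`, run/shared/lean/b2b/bsd-rank1-residual/, verbatim in every
file): the goal of the cell is to DELETE the COMBINATION-SHAPED residual classes of the
Birch–Swinnerton-Dyer formula for ALL analytic-rank `≤ 1` elliptic curves over `ℚ` — "full BSD
formula for every rank `≤ 1` curve in class `C`" assembled STRICTLY from published theorems — so
that the rank-`≤ 1` remainder becomes exactly the CONSTRUCTION-SHAPED classes, which are TYPED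
(missing-input `Prop`s), NOT attempted. This is not "finishing BSD". Census cell
(bsd-formula-census): research instrumentation; census output = EVIDENCE / conjecture items for the
kernel cell, never a Literature fact; `r = 0` cells CALIBRATION, `r = 1` cells CANDIDATE = EVIDENCE,
never a cited fact; nothing here 'confirms' anything; labels / RESIDUAL-MAP marks UNCHANGED (O7-ord
OPEN, X4♯(G-ord) / X3♯(G-ord) CONSTRUCTION-SHAPED); nothing booked. THEOREMS ONLY (no definition, no
named fact); every class-level statement is CONDITIONAL on the named published facts in its binders
(Kato 2004 Thm. 17.4 (3) component reading `hK` / Wuthrich 2014 Thm. 16 `hWu`, Delbourgo 2002 (B) via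
a (B)-datum `hB`, modularity `hmod`/`hmodD`, GZK `hGZK`, Gross–Zagier I.(7.3) `hGZ`), on the
one-number certificate `BranchUnitCertificateAt W p` (additive-p2), and on the TYPED CENSUS RELATION
`CensusX42.RelationAt W p Dh` AT THE PAIR (CANDIDATE; X42-REPORT.md sha256
`e8592c9a2e1a59c13e754928288c9f6b1ce554f7ffb80b93db3c55aa7f5e9950`, LEADERBOARD config
`813ccc7836d9197d` (Gord2); EVIDENCE block in `CensusX42LeadingTerm.lean`; since then: second-seat
RE-SCORE from the config hashes by cc-eng-1 GEN 2, `class-closure/eng-1/X42-RESCORE-cceng1.md` sha16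
`b647156fe1cef7b8`, reproduces FIT.json on every count, ablations die, planted corruption exact (INBOX
2026-08-21T07:32Z); ENG-B3 third `s₂` engine `ENGB3-isotower.md` sha16 `601904d726c3a8d2`: unit-root
input two-engine on 142/142 Gord2 rows (07:30Z) — LEADERBOARD status and caveat wording remain the
lane's pen (census-lead GEN 7, 07:36Z); label CANDIDATE UNCHANGED).

## What (the X4 analogue of conjecture-typer 2's `X11b/CensusPAdicLeadingTermBridge.lean` §4)

additive-p2 (gen 19, `GordRankOneKatoCertificateBSD.lean`) proved on X4♯(G-ord) ∩ `I₀*` ∩ {`ρ̄`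
onto}, `p ≥ 5`, `e = 2`, `r_an = 1`: Kato's divisibility + the one-number certificate + a (B)-datum
`Dh` give Schneider's `Reg_p(E,Dh) ≠ 0`, the EXACT identity
`ord_p #Ш + ord_p Reg_p(E,Dh) + ord_p ∏c + ord_p ℓ = 1 + 2·ord_p #T` (`ℓ ∣ p²`, `= 1` off the anomalous
rows), and `BSD(E,p) ⟺ ord_p q + ord_p Reg_p(E,Dh) = 1` (`L'(E,1) = q·Ω_E·Reg_∞`). The typed census
relation `CensusX42.RelationAt W p Dh` (gen 2) is, row by row, the identity
`ϖ·[T¹]B·log_p γ·#T² = α♭⁻¹ (·c_∞) · #Ш_an · Reg_p(Dh) · ∏c`; with `‖ϖ[T¹]B‖ = 1` (the certificate),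
`ord_p log_p γ = 1` (tree `X2.valuation_padicLog_cyclotomicGenerator`), `‖α♭‖ = 1`, `c_∞ ∈ {1,2}` and `#Ш_an = q·#T²/∏c` its valuation IS
`ord_p q + ord_p Reg_p(Dh) = 1` (§1, pure bookkeeping). Hence:

* §2 `ClassX4Gord.bsdp_of_censusX42_of_katoHalf_of_cert`: on X4♯(G-ord) ∩ `I₀*` ∩ {`ρ̄`
  onto}, `p ≥ 5`, non-anomalous, `r_an = 1`: certificate + Kato half + a (B)-datum `Dh` + the census
  relation AT THE PAIR for that `Dh` ⟹ `BSD(E,p)`. `…_of_shaAn_unit`: the same WITHOUT the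
  non-anomalous binder when `ord_p #Ш_an = 0` (all 141 Gord2 census rows have `#Ш_an = 1`, 42 of them
  anomalous over `ℚ(√p*)`, X42-REPORT §3 `a(E,p) = 1`): the census valuation and the exact identity give `ord_p #Ш + ord_p ℓ = ord_p #Ш_an`, so
  `ℓ = 1` is FORCED and `BSD(E,p)` follows (the kernel form of additive-p2's / rmap-2's "the fitted
  `p`-exponent is the `BSD(E,p)` defect plus the `ℓ`-reading; `b = 0` on every row").
* sequel `CensusX42BSDCorollaries.lean`: §3 the X3♯(G-ord) ∩ `I₀*` twins on Wuthrich's reducible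
  half (`RelationAt` carries no image hypothesis; the census universe is image-blind); §4 the same fed
  by Gross–Zagier I.(7.3) + A175 (no `q`/`Dh` binder) and for THE census height (gen 2's
  `RelationAtCensusHeight`, `IsTwistSigmaHeight`).

ON THE HEIGHT DATUM (read before citing §2 and the sequel): the theorems take ONE `Dh` carrying BOTH the
(B)-clauses (`LeadingTermClauses W p Dh`, Delbourgo 2002 Thm. (B) for his `⟨,⟩_{p,ℚ}`; existence =
fact A175 `Delbourgo2002.mainTheorem`) AND the census relation. That the CENSUS height (PARI 2.17.2
`ellpadicheight` with `s₂` transported from `E♭`, X42-STEP0 §4) IS Delbourgo's `⟨,⟩_{p,ℚ}` on the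
Gord2 rows is rmap-2 GEN 9's page-read READING (requests.jsonl l.1502 (2): Delbourgo 2002 pp. 38, 67
`⟨,⟩_{p,ℚ} := [K:ℚ]⁻¹⟨,⟩^{Sch}_{p,K}`; Mazur–Tate 1983 §(4.4) Proposition 'Schneider's pairing = the
canonical `ρ_c`-pairing' at good ordinary places; Mazur–Stein–Tate 2006 (1.1); norm-compatibility
`[K:ℚ] = 2`) — a READING, entered here only as the user's choice of `Dh`, never asserted; on the (M)
rows it is flagged `MT-mult-height-comparison-unread` and the (M) twin of this file WAITS for the
potentially-multiplicative certificate chain (n1011 T-O7KM) — nothing (M) is claimed here.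

What is NOT claimed: the census relation (CANDIDATE, `@[conjecture]`, hypothesis `hrel`); the
certificate (per pair, numerical); anything on (M), defect 3/4/6, `p = 3`; any booking or mark.

References: D. Delbourgo, J. Number Theory 95 (2002) Thm. (A), (B), pp. 38, 40, 67 [Delbourgo2002];
K. Kato, Astérisque 295 (2004) Thm. 17.4 (3) [Kato2004Asterisque]; C. Wuthrich, Doc. Math. 19 (2014)
Thm. 16 [Wuthrich2014]; B. Gross, D. Zagier, Invent. Math. 84 (1986) Thm. I.(7.3)
[GrossZagier1986]; B. Mazur, J. Tate, in: Arithmetic and Geometry I (1983) §4.4 [MazurTate1983];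
B. Mazur, W. Stein, J. Tate, Doc. Math. Extra Vol. (2006) (1.1) [MazurSteinTate2006]; K. Iwasawa,
Lectures on `p`-adic `L`-functions (1972) §4.4 [Iwasawa1972PadicL]; R. L. Miller, LMS J. Comput.
Math. 14 (2011) Def. 1.1 [Miller2011LMS]; census files of record (module docstring of
`CensusX42LeadingTerm.lean`); HOME/RESIDUAL-MAP.md §D addendum 9 / EVIDENCE LINE 4 (rmap-2 g9).
-/

noncomputable section

open scoped Classical MatrixGroups ModularForm NumberField

namespace Summit.BirchSwinnertonDyer.Rank1Residual.Additive

open CongruenceSubgroup WeierstrassCurve NumberField Literature.NumberTheory.EllipticCurves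
  Literature.NumberTheory.EllipticCurves.ModularForms
  Literature.NumberTheory.EllipticCurves.Rank1Residual
  Literature.NumberTheory.EllipticCurves.Rank1Residual.Typed
  Literature.NumberTheory.EllipticCurves.Delbourgo2002
  Literature.NumberTheory.GaloisRepresentations Summit.BirchSwinnertonDyer.Rank1Residual.AdditivePotMult
  IsDedekindDomain

namespace CensusX42

variable {p : ℕ} [hp : Fact p.Prime]

/-! ### §1 Bookkeeping: the valuation of the census identity on a certified row -/

/-- A `p`-adic number of norm `1` is non-zero and has valuation `0`. [folklore] -/
theorem valuation_eq_zero_of_norm_eq_one {t : ℚ_[p]} (h : ‖t‖ = 1) : t ≠ 0 ∧ t.valuation = 0 := by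
  have ht : t ≠ 0 := fun h0 ↦ by rw [h0, norm_zero] at h; exact zero_ne_one h
  refine ⟨ht, ?_⟩
  have h1 := Padic.norm_eq_zpow_neg_valuation ht
  rw [h] at h1
  have hp1 : (1 : ℝ) < p := by exact_mod_cast hp.out.one_lt
  have h2 : (p : ℝ) ^ (0 : ℤ) = (p : ℝ) ^ (-t.valuation) := by rw [zpow_zero]; exact h1
  have := zpow_right_injective₀ (by positivity) hp1.ne' h2
  omega

/-- The number of real components `c_∞ ∈ {1, 2}` is a `p`-adic unit for odd `p`. [folklore] -/
theorem numRealComponents_cast_ne_zero_and_valuation (hp2 : p ≠ 2) (W : WeierstrassCurve ℚ) :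
    ((W.baseChange ℝ).numRealComponents : ℚ_[p]) ≠ 0 ∧
      (((W.baseChange ℝ).numRealComponents : ℚ_[p])).valuation = 0 := by
  have hc : (W.baseChange ℝ).numRealComponents = 1 ∨ (W.baseChange ℝ).numRealComponents = 2 := by
    rw [numRealComponents]; split_ifs <;> simp
  have hne : ((W.baseChange ℝ).numRealComponents : ℚ_[p]) ≠ 0 := by
    rcases hc with h | h <;> · rw [h]; norm_num
  refine ⟨hne, ?_⟩
  rw [Padic.valuation_natCast]
  have : padicValNat p (W.baseChange ℝ).numRealComponents = 0 := by
    apply padicValNat.eq_zero_of_not_dvd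
    rcases hc with h | h
    · rw [h]; exact hp.out.one_lt.ne' ∘ Nat.dvd_one.mp
    · rw [h]; intro hd
      exact hp2 ((Nat.prime_dvd_prime_iff_eq hp.out Nat.prime_two).mp hd)
  exact_mod_cast this

/-- `#Ш_an = s` ⟹ `L^{(r)}(E,1)/r! = (s·∏c/#T²)·Ω_E·Reg_∞(E)` (definition of `shaAn`).
[cite: Miller2011LMS, Def. 1.1] -/
theorem leadingLCoeff_eq_of_shaAn_eq (W : WeierstrassCurve ℚ) [W.IsElliptic] {s : ℚ}
    (hs : shaAn W = (s : ℂ)) :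
    W.leadingLCoeff = ((s * W.tamagawaProduct / (W.torsionOrder : ℚ) ^ 2 : ℚ) : ℂ) *
      (W.realPeriodRat : ℂ) * (W.regulator : ℂ) := by
  have hΩ : (W.realPeriodRat : ℂ) ≠ 0 := by exact_mod_cast (W.realPeriodRat_pos_holds).ne'
  have hR : (W.regulator : ℂ) ≠ 0 := by exact_mod_cast (W.regulator_pos').ne'
  have hcp : (W.tamagawaProduct : ℂ) ≠ 0 := by
    exact_mod_cast (W.tamagawaProduct_pos_holds : 0 < W.tamagawaProduct).ne'
  have hTc : (W.torsionOrder : ℂ) ≠ 0 := by exact_mod_cast (W.torsionOrder_pos_holds).ne'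
  have hdef := shaAn_def W
  rw [hs] at hdef
  have : W.leadingLCoeff = (s : ℂ) * (W.realPeriodRat : ℂ) * (W.tamagawaProduct : ℂ) *
      (W.regulator : ℂ) / (W.torsionOrder : ℂ) ^ 2 := by
    rw [hdef]; field_simp
  rw [this]; push_cast; field_simp

/-- **The valuation of the census identity on a certified row (pure bookkeeping).** If
`x · ℓ · #T² = u · κ · (s · R · ∏c)` in `ℚ_p` with `‖x‖ = 1` (the certificate: `x = ϖ·[T¹]B`),
`ℓ ≠ 0` of valuation `1` (`ℓ = log_p γ_cyc`), `u, κ` of valuation `0` (`u = α♭⁻¹`, `κ ∈ {1, c_∞}`),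
and `s = q·#T²/∏c` (`s = #Ш_an`, `L'(E,1) = q·Ω_E·Reg_∞`), `q ≠ 0`, then `R ≠ 0` and
`ord_p q + ord_p R = 1`. [folklore] -/
theorem padicValRat_add_valuation_eq_one_of_identity {W : WeierstrassCurve ℚ} [W.IsElliptic]
    {x ℓ u κ R : ℚ_[p]} {q : ℚ} (hq : q ≠ 0) (hx : ‖x‖ = 1) (hℓ0 : ℓ ≠ 0) (hℓ : ℓ.valuation = 1)
    (hu0 : u ≠ 0) (hu : u.valuation = 0) (hκ0 : κ ≠ 0) (hκ : κ.valuation = 0)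
    (hid : x * ℓ * (W.torsionOrder : ℚ_[p]) ^ 2 =
      u * κ * (((q * (W.torsionOrder : ℚ) ^ 2 / W.tamagawaProduct : ℚ) : ℚ_[p]) * R *
        (W.tamagawaProduct : ℚ_[p]))) :
    R ≠ 0 ∧ padicValRat p q + R.valuation = 1 := by
  obtain ⟨hx0, hxv⟩ := valuation_eq_zero_of_norm_eq_one hx
  have hTpos : 0 < W.torsionOrder := W.torsionOrder_pos_holds
  have hPpos : 0 < W.tamagawaProduct := W.tamagawaProduct_pos_holds
  have hT : (W.torsionOrder : ℚ_[p]) ≠ 0 := by exact_mod_cast hTpos.ne'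
  have hP : (W.tamagawaProduct : ℚ_[p]) ≠ 0 := by exact_mod_cast hPpos.ne'
  have hTq : (W.torsionOrder : ℚ) ≠ 0 := by exact_mod_cast hTpos.ne'
  have hPq : (W.tamagawaProduct : ℚ) ≠ 0 := by exact_mod_cast hPpos.ne'
  set s : ℚ := q * (W.torsionOrder : ℚ) ^ 2 / W.tamagawaProduct with hs_def
  have hs0 : s ≠ 0 := div_ne_zero (mul_ne_zero hq (pow_ne_zero 2 hTq)) hPq
  have hsp : ((s : ℚ) : ℚ_[p]) ≠ 0 := by exact_mod_cast hs0
  have hLHS : x * ℓ * (W.torsionOrder : ℚ_[p]) ^ 2 ≠ 0 :=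
    mul_ne_zero (mul_ne_zero hx0 hℓ0) (pow_ne_zero 2 hT)
  have hRHS : u * κ * (((s : ℚ) : ℚ_[p]) * R * (W.tamagawaProduct : ℚ_[p])) ≠ 0 := by
    rw [← hid]; exact hLHS
  have hR0 : R ≠ 0 := by
    intro hR
    apply hRHS
    rw [hR, mul_zero, zero_mul, mul_zero]
  refine ⟨hR0, ?_⟩
  have hval := congrArg Padic.valuation hid
  rw [Padic.valuation_mul (mul_ne_zero hx0 hℓ0) (pow_ne_zero 2 hT), Padic.valuation_mul hx0 hℓ0,
    Padic.valuation_pow, Padic.valuation_natCast,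
    Padic.valuation_mul (mul_ne_zero hu0 hκ0) (mul_ne_zero (mul_ne_zero hsp hR0) hP),
    Padic.valuation_mul hu0 hκ0, Padic.valuation_mul (mul_ne_zero hsp hR0) hP,
    Padic.valuation_mul hsp hR0, Padic.valuation_ratCast, Padic.valuation_natCast, hxv, hℓ, hu,
    hκ] at hval
  have hsval : padicValRat p s =
      padicValRat p q + 2 * padicValNat p W.torsionOrder - padicValNat p W.tamagawaProduct := by
    rw [hs_def, padicValRat.div (mul_ne_zero hq (pow_ne_zero 2 hTq)) hPq,
      padicValRat.mul hq (pow_ne_zero 2 hTq), padicValRat.pow, padicValRat.of_nat,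
      padicValRat.of_nat]
    push_cast
    ring
  rw [hsval] at hval
  push_cast at hval
  linarith

/-- The unit root `α♭` of a good ordinary `V` gives `‖α♭⁻¹‖`: `α♭⁻¹ ≠ 0` of valuation `0`.
[cite: MazurTateTeitelbaum1986Invent, §I.11] -/
theorem unitRoot_inv_ne_zero_and_valuation (V : WeierstrassCurve ℚ) [V.IsGloballyMinimal]
    (hord : IsOrdinaryAt V p) :
    ((unitRoot V p : ℤ_[p]) : ℚ_[p])⁻¹ ≠ 0 ∧ (((unitRoot V p : ℤ_[p]) : ℚ_[p])⁻¹).valuation = 0 := by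
  obtain ⟨-, hunit⟩ := unitRoot_spec_holds V p hord
  have h1 : ‖((unitRoot V p : ℤ_[p]) : ℚ_[p])‖ = 1 := by
    rw [PadicInt.padic_norm_e_of_padicInt]; exact PadicInt.isUnit_iff.mp hunit
  obtain ⟨h0, hv⟩ := valuation_eq_zero_of_norm_eq_one h1
  exact ⟨inv_ne_zero h0, by rw [Padic.valuation_inv, hv, neg_zero]⟩

/-- **Core of §2 (cell-agnostic): on a row carrying the certificate, the census relation at the
pair reads `ord_p q + ord_p Reg_p(E,Dh) = 1`.** For `W = E` globally minimal, additive at the odd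
prime `p`, of analytic rank `1`, `L'(E,1) = q·Ω_E·Reg_∞(E)` (`q ≠ 0`), a globally minimal `V`
ORDINARY at `p` with `C • V^{(p*)} = W`, a newform `f` of `V` and the period ratio `ϖ` of the parity
of `(p−1)/2`: if the Néron-normalised branch has `‖[T¹](ϖ·B)‖ = 1` (`hone`) and
`CensusX42.RelationAt W p Dh` holds, then `Reg_p(E,Dh) ≠ 0` and `ord_p q + ord_p Reg_p(E,Dh) = 1`
(both parities: `κ = 1` at `p ≡ 1`, `κ = c_∞(E)` at `p ≡ 3 (mod 4)`).
[cite: MazurTateTeitelbaum1986Invent, §I.13] [cite: Iwasawa1972PadicL, §4.4] -/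
theorem padicValRat_add_valuation_eq_one_of_relationAt (hp2 : p ≠ 2)
    {W : WeierstrassCurve ℚ} [W.IsElliptic] [W.IsGloballyMinimal] (hadd : Addv W p)
    (hr : W.analyticRank = 1) {q : ℚ} (hq : q ≠ 0)
    (hLq : W.leadingLCoeff = (q : ℂ) * (W.realPeriodRat : ℂ) * (W.regulator : ℂ))
    (V : WeierstrassCurve ℚ) [V.IsElliptic] [V.IsGloballyMinimal] (C : VariableChange ℚ)
    (hC : C • V.quadraticTwist ((-1 : ℚ) ^ (p / 2) * p) = W) (hord : IsOrdinaryAt V p)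
    {N : ℕ} [NeZero N] {f : CuspForm (Gamma0 N) 2} (hf : IsNewformOf V f)
    (ϖ : ℚ) (hϖ : if Even (p / 2) then (ϖ : ℝ) * V.realPeriodRat = plusPeriod f
      else (ϖ : ℝ) * V.imaginaryPeriodRat = minusPeriod f)
    (hone : ‖PowerSeries.coeff 1 (PowerSeries.C (ϖ : ℚ_[p]) *
        (if Even (p / 2) then padicLFunctionBranch f ((unitRoot V p : ℤ_[p]) : ℚ_[p]) (p / 2)
          else padicLFunctionMinusBranch f ((unitRoot V p : ℤ_[p]) : ℚ_[p]) (p / 2)))‖ = 1)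
    {Dh : PAdicHeightData W p} (hrel : RelationAt W p Dh) :
    padicRegulator Dh ≠ 0 ∧ padicValRat p q + (padicRegulator Dh).valuation = 1 := by
  have hs := shaAn_eq_of_leadingLCoeff_eq W hLq
  obtain ⟨heven, hodd⟩ := hrel V C f hadd (Or.inl hord.1) hf hr _ hs
  obtain ⟨hℓ0, hℓ⟩ := X2.valuation_padicLog_cyclotomicGenerator (p := p) hp2
  obtain ⟨hu0, hu⟩ := unitRoot_inv_ne_zero_and_valuation (p := p) V hord
  have hodd4 : p % 4 = 1 ∨ p % 4 = 3 := by
    obtain ⟨k, hk⟩ := hp.out.odd_of_ne_two hp2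
    omega
  rcases hodd4 with h1 | h3
  · -- `p ≡ 1 (mod 4)`: even branch, `κ = 1`
    have hev : Even (p / 2) := ⟨p / 4, by omega⟩
    have hC' : C • V.quadraticTwist (p : ℚ) = W := by
      rw [pStar_eq_of_mod_four p (Or.inl h1), if_pos h1] at hC; exact hC
    rw [if_pos hev] at hϖ hone
    rw [PowerSeries.coeff_C_mul] at hone
    obtain ⟨-, -, hid⟩ := (heven h1 hC' ϖ hϖ).1 hord
    refine padicValRat_add_valuation_eq_one_of_identity (W := W) hq hone hℓ0 hℓ hu0 hu one_ne_zero
      Padic.valuation_one ?_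
    rw [mul_one]
    exact hid
  · -- `p ≡ 3 (mod 4)`: odd branch, `κ = c_∞(E)`
    have hnev : ¬ Even (p / 2) := by rw [Nat.not_even_iff_odd]; exact ⟨p / 4, by omega⟩
    have hC' : C • V.quadraticTwist (-(p : ℚ)) = W := by
      rw [pStar_eq_of_mod_four p (Or.inr h3), if_neg (by omega)] at hC; exact hC
    rw [if_neg hnev] at hϖ hone
    rw [PowerSeries.coeff_C_mul] at hone
    obtain ⟨-, -, hid⟩ := (hodd h3 hC' ϖ hϖ).1 hord
    obtain ⟨hκ0, hκ⟩ := numRealComponents_cast_ne_zero_and_valuation (p := p) hp2 W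
    exact padicValRat_add_valuation_eq_one_of_identity (W := W) hq hone hℓ0 hℓ hu0 hu hκ0 hκ hid

/-- `L'(E,1) = c·Ω_E·Reg_∞(E)` with `c ∈ ℚ^×` in analytic rank one (Gross–Zagier I.(7.3) + GZK; tree
`leadingLCoeff_eq_rat_mul_of_analyticRank_eq_one`), in the shape used above.
[cite: GrossZagier1986, Thm. I.(7.3)] -/
theorem exists_leadingLCoeff_eq_of_grossZagier (hGZ : GrossZagier1986_thm_I_7_3)
    (hGZK : rank_eq_analyticRank_of_analyticRank_le_one) (W : WeierstrassCurve ℚ) [W.IsElliptic]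
    (hr : W.analyticRank = 1) :
    ∃ q : ℚ, q ≠ 0 ∧ W.leadingLCoeff = (q : ℂ) * (W.realPeriodRat : ℂ) * (W.regulator : ℂ) := by
  have hrk : W.mordellWeilRank = 1 := by rw [(hGZK W hr.le).1, hr]
  obtain ⟨c, hc0, hc⟩ := leadingLCoeff_eq_rat_mul_of_analyticRank_eq_one (W := W) hGZ hr hrk
  refine ⟨c, hc0, ?_⟩
  rw [hc]; push_cast; ring

end CensusX42

open CensusX42

variable {p : ℕ} [hp : Fact p.Prime]

/-! ### §2 X4♯(G-ord) ∩ `I₀*` ∩ {`ρ̄` onto}: census relation at the pair ⟹ `BSD(E,p)` -/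

variable {W : WeierstrassCurve ℚ} [W.IsElliptic] [W.IsGloballyMinimal]

/-- **ONE NODE (X4♯(G-ord) ∩ `I₀*` ∩ {`ρ̄_{E,p}` onto}, `p ≥ 5`, `r_an = 1`, NON-ANOMALOUS; no CM
hypothesis is needed once the (B)-datum is GIVEN).** Given Kato's component divisibility (`hK`), modularity
(`hmodD`, `hmod`), GZK (`hGZK`), the one-number certificate `BranchUnitCertificateAt W p`
(additive-p2; the census's `v_p(A′) = 1` rows), a height datum `Dh` with Delbourgo's (B)-clauses
(`hB`) and `L'(E,1) = q·Ω_E·Reg_∞` (`hLq`): **the typed census relation `CensusX42.RelationAt W p Dh`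
AT THE PAIR implies `BSD(E,p)`** — by additive-p2's
`ClassX4Gord.bsdp_iff_padicVal_rankOne_of_katoHalf_of_cert` (`BSD(E,p) ⟺ ord_p q + ord_p Reg_p = 1`)
and §1 (the census identity's valuation on a certified row IS `ord_p q + ord_p Reg_p = 1`).
CONDITIONAL on `hrel` (CANDIDATE relation, EVIDENCE only) — nothing about any curve is asserted.
[cite: Kato2004Asterisque, Thm. 17.4 (3) (p. 273)] [cite: Delbourgo2002, Theorem (B) (p. 40)]
[cite: Miller2011LMS, Def. 1.1] -/
theorem ClassX4Gord.bsdp_of_censusX42_of_katoHalf_of_cert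
    (hK : Wuthrich2014.kato_halfEigenCharIdeal_dvd_cyclotomicPrime_of_surjective)
    (hmodD : nonempty_modularParametrizationData)
    (hGZK : rank_eq_analyticRank_of_analyticRank_le_one) (hmod : hasEntireLFunction_rat)
    (hX : ClassX4Gord W p) (hp5 : 5 ≤ p) (he : semistabilityIndex W p = 2) (hsurj : Surj W p)
    (hr : W.analyticRank = 1) (hna : ReductionNonAnomalous W p) (hcert : BranchUnitCertificateAt W p)
    {Dh : PAdicHeightData W p} (hB : LeadingTermClauses W p Dh) (hrel : RelationAt W p Dh)
    {q : ℚ} (hLq : W.leadingLCoeff = (q : ℂ) * (W.realPeriodRat : ℂ) * (W.regulator : ℂ)) :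
    BSDp W p := by
  rw [hX.bsdp_iff_padicVal_rankOne_of_katoHalf_of_cert hK hmodD hGZK hmod hp5 he hsurj hr hna hcert hB
    hLq]
  have hp2 : p ≠ 2 := by omega
  have hq : q ≠ 0 := by
    rintro rfl
    rw [Rat.cast_zero, zero_mul, zero_mul] at hLq
    exact W.leadingLCoeff_ne_zero_holds (hmod W) hLq
  obtain ⟨V, iV, iVm, C, hV, hC⟩ := hX.exists_goodOrd_pStar_twist_model W p he
  haveI : NeZero (V.conductorNorm ℤ) := ⟨(V.conductorNorm_pos_holds).ne'⟩
  obtain ⟨Dm⟩ := hmodD V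
  obtain ⟨ϖ, hϖ⟩ := exists_periodRatio_parity (p := p) V Dm
  have hord : IsOrdinaryAt V p := hV
  obtain ⟨-, hone⟩ := hcert V C hC hord Dm.f Dm.isNewformOf ϖ hϖ
  exact (padicValRat_add_valuation_eq_one_of_relationAt hp2 hX.addv.2 hr hq hLq V C hC hord
    Dm.isNewformOf ϖ hϖ hone hrel).2

/-- **ONE NODE without the non-anomalous binder, on the `#Ш_an`-UNIT rows** (all 141 Gord2 census
rows have `#Ш_an = 1`; 42 of them are anomalous — X42-REPORT §3 `a(E,p) = 1`, i.e. `p ∣ #Ẽ(𝔽_p)`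
over `ℚ(√p*)`): X4♯(G-ord) ∩ `I₀*` ∩ {`ρ̄` onto},
`p ≥ 5`, `r_an = 1`, certificate, Kato half, a (B)-datum `Dh`, `#Ш_an = s` with `ord_p s = 0`, and the
census relation at the pair ⟹ **`BSD(E,p)`, and the `ℓ` of the exact identity is `1`** — because the
census valuation `ord_p q + ord_p Reg_p = 1` and additive-p2's exact identity
`ord_p #Ш + ord_p Reg_p + ord_p ∏c + ord_p ℓ = 1 + 2 ord_p #T` give `ord_p #Ш + ord_p ℓ = ord_p #Ш_an`.
(Kernel form of the census reading "the fitted `p`-exponent `b` of `R` is the `BSD(E,p)` defect plus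
the `ℓ`-reading; `b = 0` on 141/141", EVIDENCE; the literal `ℓ_p = |c_p|_p·p²` reading on anomalous
rows is thereby EXCLUDED on every such row GIVEN `hrel` — flag `Del02-ThmB-ellp-anomalous`.)
[cite: Delbourgo2002, Theorem (B) (p. 40)] [cite: Kato2004Asterisque, Thm. 17.4 (3) (p. 273)]
[cite: Miller2011LMS, Def. 1.1] -/
theorem ClassX4Gord.bsdp_of_censusX42_of_katoHalf_of_cert_of_shaAn_unit
    (hK : Wuthrich2014.kato_halfEigenCharIdeal_dvd_cyclotomicPrime_of_surjective)
    (hmodD : nonempty_modularParametrizationData)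
    (hGZK : rank_eq_analyticRank_of_analyticRank_le_one) (hmod : hasEntireLFunction_rat)
    (hX : ClassX4Gord W p) (hp5 : 5 ≤ p) (he : semistabilityIndex W p = 2) (hsurj : Surj W p)
    (hr : W.analyticRank = 1) (hcert : BranchUnitCertificateAt W p)
    {Dh : PAdicHeightData W p} (hB : LeadingTermClauses W p Dh) (hrel : RelationAt W p Dh)
    {s : ℚ} (hs : shaAn W = (s : ℂ)) (hsv : padicValRat p s = 0) :
    BSDp W p ∧
      (padicValNat p W.shaOrder : ℤ) + (padicRegulator Dh).valuation +
          padicValNat p W.tamagawaProduct = 1 + 2 * padicValNat p W.torsionOrder := by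
  have hp2 : p ≠ 2 := by omega
  have hLq := leadingLCoeff_eq_of_shaAn_eq W hs
  set q : ℚ := s * W.tamagawaProduct / (W.torsionOrder : ℚ) ^ 2 with hq_def
  have hq : q ≠ 0 := by
    rintro h0
    rw [h0, Rat.cast_zero, zero_mul, zero_mul] at hLq
    exact W.leadingLCoeff_ne_zero_holds (hmod W) hLq
  have hTq : (W.torsionOrder : ℚ) ≠ 0 := by exact_mod_cast (W.torsionOrder_pos_holds).ne'
  have hPq : (W.tamagawaProduct : ℚ) ≠ 0 := by
    exact_mod_cast (W.tamagawaProduct_pos_holds : 0 < W.tamagawaProduct).ne'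
  have hs0 : s ≠ 0 := by
    rintro rfl
    exact hq (by rw [hq_def, zero_mul, zero_div])
  -- the census valuation
  obtain ⟨V, iV, iVm, C, hV, hC⟩ := hX.exists_goodOrd_pStar_twist_model W p he
  haveI : NeZero (V.conductorNorm ℤ) := ⟨(V.conductorNorm_pos_holds).ne'⟩
  obtain ⟨Dm⟩ := hmodD V
  obtain ⟨ϖ, hϖ⟩ := exists_periodRatio_parity (p := p) V Dm
  have hord : IsOrdinaryAt V p := hV
  obtain ⟨-, hone⟩ := hcert V C hC hord Dm.f Dm.isNewformOf ϖ hϖ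
  obtain ⟨-, hcensus⟩ := padicValRat_add_valuation_eq_one_of_relationAt hp2 hX.addv.2 hr hq hLq V C
    hC hord Dm.isNewformOf ϖ hϖ hone hrel
  -- the exact identity
  obtain ⟨-, ℓ, hℓp, -, hid⟩ :=
    hX.schneider_and_padicVal_identity_rankOne_of_katoHalf_of_cert hK hmodD hGZK hp5 he hsurj hr hcert hB
  -- `ord_p q = ord_p s + ord_p ∏c − 2 ord_p #T`
  have hqval : padicValRat p q =
      padicValRat p s + padicValNat p W.tamagawaProduct - 2 * padicValNat p W.torsionOrder := by
    rw [hq_def, padicValRat.div (mul_ne_zero hs0 hPq) (pow_ne_zero 2 hTq), padicValRat.mul hs0 hPq,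
      padicValRat.pow, padicValRat.of_nat, padicValRat.of_nat]
    push_cast
    ring
  have hℓ0 : (padicValNat p ℓ : ℤ) = 0 := by
    have h1 : (0 : ℤ) ≤ padicValNat p ℓ := by positivity
    have h2 : (0 : ℤ) ≤ padicValNat p W.shaOrder := by positivity
    rw [hsv] at hqval
    linarith
  refine ⟨?_, by linarith⟩
  have hid' : (padicValNat p W.shaOrder : ℤ) + ((padicRegulator Dh).valuation + padicValNat p ℓ) +
      padicValNat p W.tamagawaProduct = 1 + 2 * padicValNat p W.torsionOrder := by linarith
  rw [bsdp_iff_padicValRat_add_eq_one (W := W) (p := p) hGZK (by rw [hr]) hq hLq hid']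
  linarith


end Summit.BirchSwinnertonDyer.Rank1Residual.Additive

end
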